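import Summits.AtomisticToContinuum.BoseEinsteinCondensation.Theorems.BECClassicalWindowThermalGroundStateLimitModeCount
import Mathlib.Analysis.Real.Pi.Bounds

/-!
# Route `BECClassicalWindow` — support item `ThermalGroundStateLimit` (stmt-AtomisticToContinuum-9073):
# the partition function of the Dirichlet box is finite, in ensemble form

Helper file for stmt-AtomisticToContinuum-9073 (`ThermalGroundStateLimit`). Third ingredient,
**`Tr e^{-H} < ∞` on finite orthogonal ensembles** (`exists_sum_exp_neg_energy_le`): there is
`Z = Z(N, L) < ∞` such that every finite `L²`-orthonormal family `(Ψᵢ)` of Dirichlet trial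
states of finite energy satisfies `∑ᵢ e^{-⟨Ψᵢ, H_N Ψᵢ⟩} ≤ Z`. The interaction is `≥ 0`, so
`⟨Ψ, HΨ⟩ ≥ ∫|∇Ψ|²`; group the family into unit energy shells `⌊⟨Ψᵢ,HΨᵢ⟩⌋ = j` and bound each
shell by the mode count `card_le_of_lintegral_kineticDensity_le` at `Λ = j + 1`, which grows
polynomially in `j`, against `e^{-j}`.
-/

noncomputable section

namespace Summit.AtomisticToContinuum.BoseEinsteinCondensation.Theorems

open MeasureTheory Filter Set Complex
open scoped ENNReal NNReal Topology ComplexConjugate BigOperators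
open Literature.MathematicalPhysics.QuantumManyBody.BoseGas
open Literature.MathematicalPhysics.QuantumManyBody

namespace ThermalGroundStateLimit

variable {N : ℕ} {L : ℝ}

/-! ### The partition bound -/

/-- The energy dominates the kinetic energy (`v ≥ 0`). [folklore] -/
theorem lintegral_kineticDensity_le_energy (v : ℝ → ℝ≥0∞) (Ψ : TrialState N L) :
    ∫⁻ X, kineticDensity Ψ.ψ X ≤ energy v Ψ :=
  lintegral_mono fun _ => le_self_add

/-- The mode-count majorant `M(Λ) = 2(2⌊L√(2Λ)/(2π)⌋ + 1)^{3N}` grows at most polynomially: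
`M(j+1) ≤ 2 (L(j+1) + 1)^{3N} ≤ 2 (L+1)^{3N} (j+1)^{3N}`. [folklore] -/
theorem modeCount_le (hL : 0 < L) (j : ℕ) :
    (2 * (2 * ⌊L * Real.sqrt (2 * ((j : ℝ) + 1)) / (2 * Real.pi)⌋₊ + 1) ^ (N * 3) : ℝ) ≤
      2 * (L + 1) ^ (N * 3) * ((j : ℝ) + 1) ^ (N * 3) := by
  have hj1 : (1 : ℝ) ≤ (j : ℝ) + 1 := by simp
  have hsqrt : Real.sqrt (2 * ((j : ℝ) + 1)) ≤ 2 * ((j : ℝ) + 1) := by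
    rw [Real.sqrt_le_left (by positivity)]
    nlinarith
  have hfloor : (⌊L * Real.sqrt (2 * ((j : ℝ) + 1)) / (2 * Real.pi)⌋₊ : ℝ) ≤
      L * ((j : ℝ) + 1) / 2 := by
    refine (Nat.floor_le (by positivity)).trans ?_
    rw [div_le_div_iff₀ (by positivity) (by positivity)]
    have hpi : (3 : ℝ) ≤ Real.pi := by linarith [Real.pi_gt_three]
    calc L * Real.sqrt (2 * ((j : ℝ) + 1)) * 2 ≤ L * (2 * ((j : ℝ) + 1)) * 2 := by gcongr
      _ = L * ((j : ℝ) + 1) * 4 := by ring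
      _ ≤ L * ((j : ℝ) + 1) * (2 * Real.pi) := by gcongr; linarith
  have hbase : (2 * ⌊L * Real.sqrt (2 * ((j : ℝ) + 1)) / (2 * Real.pi)⌋₊ + 1 : ℝ) ≤
      (L + 1) * ((j : ℝ) + 1) := by nlinarith
  rw [mul_assoc, ← mul_pow]
  gcongr

/-- The majorant series `∑ⱼ 2(L+1)^{3N}(j+1)^{3N} e^{-j}` converges. [folklore] -/
theorem summable_modeCount_majorant (L : ℝ) (N : ℕ) :
    Summable fun j : ℕ => 2 * (L + 1) ^ (N * 3) * ((j : ℝ) + 1) ^ (N * 3) * Real.exp (-(j : ℝ)) := by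
  have h := (Real.summable_pow_mul_exp_neg_nat_mul (N * 3) zero_lt_one)
  have h1 : Summable fun j : ℕ => ((j + 1 : ℕ) : ℝ) ^ (N * 3) * Real.exp (-1 * ((j + 1 : ℕ) : ℝ)) :=
    (summable_nat_add_iff 1).2 h
  have h2 : Summable fun j : ℕ => ((j : ℝ) + 1) ^ (N * 3) * Real.exp (-(j : ℝ)) := by
    refine ((h1.mul_left (Real.exp 1)).congr fun j => ?_)
    push_cast
    rw [show -1 * ((j : ℝ) + 1) = -(j : ℝ) - 1 by ring, Real.exp_sub]
    field_simp
  simpa [mul_assoc] using h2.mul_left (2 * (L + 1) ^ (N * 3))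

/-- **The partition function of the Dirichlet box is finite, ensemble form.** For `L > 0` there is
`Z < ∞` (depending on `N, L` only) such that for every finite family `(Ψᵢ)_{i<m}` of Dirichlet
trial states of `Λ_L^N`, every sub-family `s` that is `L²`-orthonormal and of finite energy
satisfies `∑_{i ∈ s} e^{-⟨Ψᵢ, H_N Ψᵢ⟩} ≤ Z` — i.e. `Tr_s e^{-H_N} ≤ Z` on finite-rank diagonal
density matrices in the `C¹` form core (compact resolvent of the Dirichlet Laplacian; here from the
counting bound `card_le_of_lintegral_kineticDensity_le` on unit energy shells). [folklore] -/
theorem exists_sum_exp_neg_energy_le (hL : 0 < L) (v : ℝ → ℝ≥0∞) (N : ℕ) :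
    ∃ Z : ℝ, 1 ≤ Z ∧ ∀ (m : ℕ) (Ψ : Fin m → TrialState N L) (s : Finset (Fin m)),
      (∀ i ∈ s, ∀ j ∈ s, i ≠ j → ∫ X, conj ((Ψ i).ψ X) * (Ψ j).ψ X = 0) →
      (∀ i ∈ s, energy v (Ψ i) ≠ ⊤) →
        ∑ i ∈ s, Real.exp (-(energy v (Ψ i)).toReal) ≤ Z := by
  classical
  set b : ℕ → ℝ := fun j => 2 * (L + 1) ^ (N * 3) * ((j : ℝ) + 1) ^ (N * 3) * Real.exp (-(j : ℝ))
    with hb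
  have hbs : Summable b := summable_modeCount_majorant L N
  have hb0 : ∀ j, 0 ≤ b j := fun j => by positivity
  have htsum0 : 0 ≤ ∑' j, b j := tsum_nonneg hb0
  refine ⟨∑' j, b j + 1, by linarith, fun m Ψ s horth hfin => ?_⟩
  -- energies as reals and their integer shells
  set E : Fin m → ℝ := fun i => (energy v (Ψ i)).toReal with hE
  have hE0 : ∀ i, 0 ≤ E i := fun i => ENNReal.toReal_nonneg
  set shell : Fin m → ℕ := fun i => ⌊E i⌋₊ with hshell
  -- each shell is an orthonormal family with kinetic energy `< j + 1`, hence small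
  have hcard : ∀ j : ℕ, ((s.filter fun i => shell i = j).card : ℝ) ≤
      2 * (L + 1) ^ (N * 3) * ((j : ℝ) + 1) ^ (N * 3) := by
    intro j
    set t := s.filter fun i => shell i = j with ht
    have hkin : ∀ i : t, ∫⁻ X, kineticDensity (Ψ i).ψ X ≤ ENNReal.ofReal ((j : ℝ) + 1) := by
      rintro ⟨i, hi⟩
      rw [ht, Finset.mem_filter] at hi
      refine (lintegral_kineticDensity_le_energy v (Ψ i)).trans ?_
      rw [← ENNReal.ofReal_toReal (hfin i hi.1)]
      refine ENNReal.ofReal_le_ofReal ?_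
      have h1 := Nat.lt_floor_add_one (E i)
      have h2 : (⌊E i⌋₊ : ℝ) = j := by exact_mod_cast hi.2
      rw [h2] at h1
      exact h1.le
    have horth' : ∀ i j : t, i ≠ j → ∫ X, conj ((Ψ i).ψ X) * (Ψ j).ψ X = 0 := by
      rintro ⟨i, hi⟩ ⟨i', hi'⟩ hne
      rw [ht, Finset.mem_filter] at hi hi'
      exact horth i hi.1 i' hi'.1 fun h => hne (Subtype.ext h)
    have h := card_le_of_lintegral_kineticDensity_le hL (fun i : t => Ψ i) horth'
      (by positivity) hkin
    rw [Fintype.card_coe] at h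
    calc (t.card : ℝ) ≤ (2 * (2 * ⌊L * Real.sqrt (2 * ((j : ℝ) + 1)) / (2 * Real.pi)⌋₊ + 1) ^
          (N * 3) : ℕ) := by exact_mod_cast h
      _ ≤ 2 * (L + 1) ^ (N * 3) * ((j : ℝ) + 1) ^ (N * 3) := by
          push_cast; exact modeCount_le hL j
  -- `e^{-E} ≤ e^{-⌊E⌋}`, regroup by shells, bound each shell, compare with the full series
  calc ∑ i ∈ s, Real.exp (-E i) ≤ ∑ i ∈ s, Real.exp (-(shell i : ℝ)) := by
        refine Finset.sum_le_sum fun i _ => Real.exp_le_exp.2 ?_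
        exact neg_le_neg (Nat.floor_le (hE0 i))
    _ = ∑ j ∈ s.image shell, ((s.filter fun i => shell i = j).card : ℝ) * Real.exp (-(j : ℝ)) := by
        rw [Finset.sum_comp (fun j : ℕ => Real.exp (-(j : ℝ))) shell]
        simp only [nsmul_eq_mul]
    _ ≤ ∑ j ∈ s.image shell, b j := by
        refine Finset.sum_le_sum fun j _ => ?_
        rw [hb]
        exact mul_le_mul_of_nonneg_right (hcard j) (Real.exp_nonneg _)
    _ ≤ ∑' j, b j := hbs.sum_le_tsum _ fun j _ => hb0 j
    _ ≤ ∑' j, b j + 1 := by linarith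

end ThermalGroundStateLimit

end Summit.AtomisticToContinuum.BoseEinsteinCondensation.Theorems

end
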